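import Summits.Ventures.HodgeRepro2.T6N41PlaceSplit

/-!
# T6N41PlaceSplitLQ — the Langlands-quotient carrier of the split layer (Tier 6, M2; definition lane; owner t6-p4)

Mínguez's Théorème 1 (2) describes the theta lift as «le quotient de Langlands de» an induced representation
(p. 718 l. 44); Bump's Theorem 4.5.1 says when the induced representation `ℬ(χ₁, χ₂)` of `GL(2, F)` is
irreducible (and then, p0471 l. 12, «its isomorphism class is denoted `π(χ₁, χ₂)`» — the `psF` of the split
datum).  The two printed statements meet on ONE carrier, added here over the split datum `Sp` (append-only:
`SplitDatum` p402832 is not revised): `LQ v a b` = the Langlands quotient of the principal series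
`ℬ(χ₁, χ₂) = χ₁ × χ₂` of `GL₂(F_v)` induced from the unramified characters `χ₁, χ₂` of `F_v^×` with
`χ₁(ϖ_v) = a`, `χ₂(ϖ_v) = b` (Bump (5.2) p0471 l. 10 `ℬ(χ₁, χ₂) = Ind_{B(F)}^{GL(2,F)}(χ)`; Mínguez §6), read on
`U(W_{A,v}) ≅ GL₂(F_v)` through the isomorphism of TIER5 §N4.1.9 (A′-1) exactly as `Sp.psF`, `Sp.θII` are.
No field beyond the carrier: what is true of it is the two displays of `T6N41PlaceSplitHyp.lean`
(`Hyp.Minguez2008_Thm1_2_LQ`, `Hyp.Bump1997_Thm4_5_1`).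

§8(d): uses an L-value-free non-vanishing device: NO.
-/

namespace Summit.Ventures.HodgeRepro2.T6

/-- The Langlands-quotient carrier over the split datum `Sp`. -/
structure SplitLQ {ι : Type*} {D : DoublingLDatum ι} {Pl : PlacementDatum D} {In : InertDatum Pl}
    (Sp : SplitDatum In) where
  /-- `LQ v a b` — the Langlands quotient («quotient de Langlands», Mínguez §6) of the principal series
  `ℬ(χ₁, χ₂) = Ind_{B(F_v)}^{GL(2, F_v)}(χ)` (Bump (5.2)) induced from the unramified characters `χ₁, χ₂` of
  `F_v^×` with `χ₁(ϖ_v) = a`, `χ₂(ϖ_v) = b`, as a representation of `U(W_{A,v}) ≅ GL₂(F_v)` at a split `v` -/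
  LQ : ∀ v, ℂˣ → ℂˣ → In.RepU v

end Summit.Ventures.HodgeRepro2.T6
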